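import Literature.IUT.HodgeTheaters.GoodLocalFrobenioidOfGaloisCdashFromF
import HarnessLib

/-!
# [IUTchI] Example 3.3 (iii) (d) over the REAL bases: the ramification clause `hram` reduced to the base category

Mochizuki, *Inter-universal Teichmüller theory I*, kurims manuscript (May 2020), Example 3.3 (iii) (d), p. 79
[claim: Mochizuki2012, status: disputed] — nothing of the series is asserted; no side is taken on [IUTchIII]
Cor. 3.12. Mochizuki, *The geometry of Frobenioids I*, Theorem 3.4 (v), p. 63 [cite: MochizukiFrdI2008, Thm. 3.4 (v) p.63].

PROOF-ONLY (abc-iut cell, seat abc-iut-w4-d047 gen 4; row E33iii/d, STEP C′), 0 definitions, no new Prop fact.  After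
`GoodLocalFrobenioidOfGaloisCdashFromF.lean` the only non-fact residual of clause (d) over the real bases is the
ramification clause `hram` of abc-iut-L1-t4's `cdashFromF_ofKit_of‴`: for every self-equivalence `e` of `C_v` and every
object `X`, the value monoids `ord(𝒪^▷)` of the fields under `Base X` and `Base e(X)` are isomorphic over `ord(p_v)`.
THIS FILE moves that residual from the Frobenioid `C_v` down to its base category `D_v = CosetCat Π_v`:
* `PadicFrd.PadicFld.exists_ordInt_mulEquiv_of_iso` — an isomorphism `Spec L ≅ Spec L'` of `D₀` gives
  `ord(𝒪_L^▷) ≅ ord(𝒪_{L'}^▷)` over `ord(p)`;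
* `GoodLocalFrobenioid.hram_ofGalois_of_base` — by [FrdI] Thm. 3.4 (v) (kernel theorem `FrdI.Thm34v_holds`,
  `Base e(X) ≅ Ψ^Base(Base X)`), `hram` follows from its BASE-LEVEL form `hbaseRam`: every self-equivalence `E` of
  `CosetCat Π_v` and every `A` admit `ord(𝒪^▷_{K_A}) ≅ ord(𝒪^▷_{K_{E A}})` over `ord(p_v)` (`K_A` the field under `A`);
* `GoodLocalFrobenioid.cdashFromF_ofGalois_of_baseRam` — hence (d) over the real bases from `hΔ` (FACT F-0007 shape),
  slimness, and `hbaseRam` — a statement about `𝓑(Π_v)⁰` and the field functor only, where [AbsAnab] Prop. 1.2.1 (v)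
  ("ramification indices are group-theoretic") applies through the action of `E` on objects by a bicontinuous
  automorphism of `Π_v` up to conjugacy (`BaseGaloisSystem.exists_continuousMulEquiv_forall_obj_conj_of_cosetCat_equivalence`).
-/

namespace Literature.AlgebraicGeometry.Frobenioids.PadicFrd.PadicFld

open CategoryTheory

universe u

variable {p : ℕ}

/-- An isomorphism `Spec L ≅ Spec L'` in the base category `D₀` of `p`-adic valued fields induces an isomorphism
`ord(𝒪_L^▷) ≅ ord(𝒪_{L'}^▷)` of value monoids carrying `ord(p)` to `ord(p)` (field isomorphisms compatible with the
valuations; they fix `p`). [cite: MochizukiFrdII2008, Ex 1.1 (i) p.7] -/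
theorem exists_ordInt_mulEquiv_of_iso {X Y : PadicFld.{u} p} (f : X ≅ Y) :
    ∃ ι : OrdInt X.K ≃* OrdInt Y.K,
      ι (Associates.mk ⟨((p : ℕ) : X.K), X.p_mem⟩) = Associates.mk ⟨((p : ℕ) : Y.K), Y.p_mem⟩ := by
  have h₁ : ∀ y : X.K, f.hom.alg (f.inv.alg y) = y := fun y => by
    have h := congrArg (fun g : X ⟶ X => g.alg y) f.hom_inv_id
    simp only [comp_alg, id_alg, RingHom.comp_apply, RingHom.id_apply] at h
    exact h
  have h₂ : ∀ z : Y.K, f.inv.alg (f.hom.alg z) = z := fun z => by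
    have h := congrArg (fun g : Y ⟶ Y => g.alg z) f.inv_hom_id
    simp only [comp_alg, id_alg, RingHom.comp_apply, RingHom.id_apply] at h
    exact h
  refine ⟨{ toFun := ordIntMapOfHom f.inv.alg f.inv.isValHom
            invFun := ordIntMapOfHom f.hom.alg f.hom.isValHom
            left_inv := fun a => ?_
            right_inv := fun b => ?_
            map_mul' := fun a b => map_mul _ a b }, ?_⟩
  · obtain ⟨x, rfl⟩ := Associates.mk_surjective a
    rw [ordIntMapOfHom_mk, ordIntMapOfHom_mk]
    exact congrArg Associates.mk (Subtype.ext (h₁ x.1))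
  · obtain ⟨x, rfl⟩ := Associates.mk_surjective b
    rw [ordIntMapOfHom_mk, ordIntMapOfHom_mk]
    exact congrArg Associates.mk (Subtype.ext (h₂ x.1))
  · change ordIntMapOfHom f.inv.alg f.inv.isValHom (Associates.mk _) = _
    rw [ordIntMapOfHom_mk]
    exact congrArg Associates.mk (Subtype.ext (map_natCast f.inv.alg p))

end Literature.AlgebraicGeometry.Frobenioids.PadicFrd.PadicFld

namespace Literature.IUT.HodgeTheaters

namespace GoodLocalFrobenioid

open CategoryTheory Opposite Literature.AnabelianGeometry.SemiGraphs Literature.AlgebraicGeometry.Frobenioids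
open Literature.AlgebraicGeometry.Frobenioids.PadicFrd Topology

universe u

variable {p : ℕ} [Fact p.Prime] (d : GaloisValDatum.{u} p) {P : Type u} [Group P] [TopologicalSpace P]
  (aug : P →* d.Gal) (hc : Continuous aug) (hs : Function.Surjective aug) (ho : IsOpenMap aug)
  (Kv : Type) [Field Kv] [ValuativeRel Kv] (hp : ((p : Kv)) ∈ PadicFrd.intNonzero Kv)

/-- **`hram` from its base-level form.**  For every self-equivalence `e` of the REAL `p_v`-adic Frobenioid `C_v` over
`D_v = CosetCat Π_v` (`GoodLocalFrobenioid.ofGalois`) and every object `X`, [FrdI] Thm. 3.4 (v) (kernel theorem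
`FrdI.Thm34v_holds`; `C_v` of standard type by [FrdII] Thm. 1.2 (i) over the FSM-type base, (b) vacuous, (c) = `hsl`)
gives `Base e(X) ≅ Ψ^Base(Base X)` for a self-equivalence `Ψ^Base` of `D_v`; so the ramification clause for `e` follows
from the same clause `hbaseRam` for the self-equivalences of the BASE (and `PadicFld.exists_ordInt_mulEquiv_of_iso`).
([IUTchI] Ex 3.3 (iii) (d) p.79) [claim: Mochizuki2012, status: disputed] -/
theorem hram_ofGalois_of_base [IsTopologicalGroup P] (hsl : IsSlim (CosetCat P))
    (hbaseRam : ∀ (E : CosetCat P ≌ CosetCat P) (A : CosetCat P),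
      ∃ ι : OrdInt ((CosetCat.push aug ho ⋙ d.fieldFunctor).obj A).K ≃*
          OrdInt ((CosetCat.push aug ho ⋙ d.fieldFunctor).obj (E.functor.obj A)).K,
        ι (Associates.mk ⟨((p : ℕ) : ((CosetCat.push aug ho ⋙ d.fieldFunctor).obj A).K),
            ((CosetCat.push aug ho ⋙ d.fieldFunctor).obj A).p_mem⟩) =
          Associates.mk ⟨((p : ℕ) : ((CosetCat.push aug ho ⋙ d.fieldFunctor).obj (E.functor.obj A)).K),
            ((CosetCat.push aug ho ⋙ d.fieldFunctor).obj (E.functor.obj A)).p_mem⟩)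
    (e : (ofGalois d aug hc hs ho Kv hp).Cv ≌ (ofGalois d aug hc hs ho Kv hp).Cv)
    (X : (ofGalois d aug hc hs ho Kv hp).Cv) :
    ∃ ι : OrdInt ((CosetCat.push aug ho ⋙ d.fieldFunctor).obj X.base).K ≃*
        OrdInt ((CosetCat.push aug ho ⋙ d.fieldFunctor).obj (e.functor.obj X).base).K,
      ι (Associates.mk ⟨((p : ℕ) : ((CosetCat.push aug ho ⋙ d.fieldFunctor).obj X.base).K),
          ((CosetCat.push aug ho ⋙ d.fieldFunctor).obj X.base).p_mem⟩) =
        Associates.mk ⟨((p : ℕ) : ((CosetCat.push aug ho ⋙ d.fieldFunctor).obj (e.functor.obj X).base).K),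
          ((CosetCat.push aug ho ⋙ d.fieldFunctor).obj (e.functor.obj X).base).p_mem⟩ := by
  -- the REAL `p_v`-adic Frobenioid datum of `C_v` over `D_v = CosetCat Π_v`
  let Q : Datum (CosetCat P) p := Datum.perf (CosetCat.push aug ho ⋙ d.fieldFunctor)
    (hlocOver (CosetCat.push aug ho) d.fieldFunctor d.fieldFunctor_isPadicLocal)
    CosetCat.isConnected CosetCat.isTotallyEpimorphic
  have hD : IsOfFSMType (CosetCat P) := CosetCat.isOfFSMType
  have hF : PreFrobenioid.IsFrobenioid Q.structureFunctor := Q.isFrobenioid_of_isOfFSMType hD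
  have hstd : (ModelFrobenioid.data Q.Φ Q.B Q.divB).IsOfStandardType := Q.thm12_isOfStandardType_of_isOfFSMType hD
  have hB : (ModelFrobenioid.data Q.Φ Q.B Q.divB).HypB (ModelFrobenioid.data Q.Φ Q.B Q.divB) e :=
    fun hg _ => absurd (hg.obj X) (Q.thm12_not_isGroupLikeObj X)
  obtain ⟨-, -, ΨBase, ⟨hEq, ⟨η⟩, -⟩, -⟩ :=
    FrdI.Thm34v_holds Q.structureFunctor Q.structureFunctor hF hF e hstd hstd hB hsl hsl
  haveI : ΨBase.IsEquivalence := hEq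
  -- `Base X ↦ Ψ^Base(Base X)` (base level), then `Ψ^Base(Base X) ≅ Base e(X)` (an isomorphism of `D_v`)
  obtain ⟨ι₁, hι₁⟩ := hbaseRam ΨBase.asEquivalence X.base
  obtain ⟨ι₂, hι₂⟩ := PadicFld.exists_ordInt_mulEquiv_of_iso
    ((CosetCat.push aug ho ⋙ d.fieldFunctor).mapIso (η.app X).symm)
  exact ⟨ι₁.trans ι₂, by rw [MulEquiv.trans_apply, hι₁]; exact hι₂⟩

/-- **[IUTchI] Ex. 3.3 (iii) (d) over the REAL bases from BASE-LEVEL inputs only**: `hΔ` ([AbsAnab] Lem. 1.3.8, FACT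
F-0007 shape), slimness of `𝓑(Π_v)⁰`, and the base-level ramification clause `hbaseRam` (self-equivalences of
`𝓑(Π_v)⁰` preserve `ord(𝒪^▷)` over `ord(p_v)` of the fields under the objects — the printed [AbsAnab] Prop. 1.2.1 (v)
content). ([IUTchI] Ex 3.3 (iii) (d) p.79) [claim: Mochizuki2012, status: disputed] -/
theorem cdashFromF_ofGalois_of_baseRam [IsTopologicalGroup P] [SecondCountableTopology P] (hP : IsTempered P)
    (hΔ : ∀ φ : P ≃ₜ* P, aug.ker.map φ.toMulEquiv.toMonoidHom = aug.ker) (hsl : IsSlim (CosetCat P))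
    (hbaseRam : ∀ (E : CosetCat P ≌ CosetCat P) (A : CosetCat P),
      ∃ ι : OrdInt ((CosetCat.push aug ho ⋙ d.fieldFunctor).obj A).K ≃*
          OrdInt ((CosetCat.push aug ho ⋙ d.fieldFunctor).obj (E.functor.obj A)).K,
        ι (Associates.mk ⟨((p : ℕ) : ((CosetCat.push aug ho ⋙ d.fieldFunctor).obj A).K),
            ((CosetCat.push aug ho ⋙ d.fieldFunctor).obj A).p_mem⟩) =
          Associates.mk ⟨((p : ℕ) : ((CosetCat.push aug ho ⋙ d.fieldFunctor).obj (E.functor.obj A)).K),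
            ((CosetCat.push aug ho ⋙ d.fieldFunctor).obj (E.functor.obj A)).p_mem⟩) :
    (ofGalois d aug hc hs ho Kv hp).CdashFromF :=
  cdashFromF_ofGalois_of d aug hc hs ho Kv hp hP hΔ hsl (hram_ofGalois_of_base d aug hc hs ho Kv hp hsl hbaseRam)

end GoodLocalFrobenioid

end Literature.IUT.HodgeTheaters
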